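import Summits.BirchSwinnertonDyer.BirchSwinnertonDyer.Theorems.GenusKolyvaginAtTwoTorsionCellSELTwistCount
import Summits.BirchSwinnertonDyer.BirchSwinnertonDyer.Theorems.GenusKolyvaginAtTwoTorsionCellD0Closer
import HarnessLib

/-!
# SEL (iso-class Selmer pair law), V-f: the `C₀` conjunct of LINE 49's `IsoClassSelmerPairLawAtTwo` from the full base setting

Crux R″ `RankOneTwoTorsionResidualAtTwo` (stmt-27478), LINE 49 «full_vertex» (pen bsd-idea-1), SUPPORT stub SEL
`IsoClassSelmerPairLawAtTwo`.  This file discharges the bookkeeping between the line's hypotheses — `FullBaseSetting`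
(two independent rational `2`-torsion points, `Ш(E₀)[2] = 0`, full-admissible `Q₀` with `M₀ = ∏ q* > 0`), rank `0`,
`IsIsoClass N₀ Q₀` (the Defs' predicate), `IsGenusPair` (a model `C₀ = T • E₀^{(M₀)}`) — and the symbol-form count of part
V-e, giving the **`C₀` CONJUNCT of the law**:

* **`isoClassSelmerLaw_C₀`** — `#C₀(ℚ)[2] = 4` and `#Sel⁽²⁾(C₀/ℚ) = 4 · #ker Φ₃(redeiLaplacian Q₀)`, for every model `C₀` of
  `E₀^{(M₀)}`, every even `#Q₀` (including `Q₀ = ∅`: `C₀ ≅ E₀`, `#Sel⁽²⁾ = 4`, empty matrix).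

Steps: `M₀ = ∏ q* = ∏ q` and `#Q₀` even (full-admissible ⟹ `q ≡ 3 (mod 4)`, `M₀ > 0`); `IsIsoClass` ⟹ the pairwise symbol
conditions of parts I–V; full-admissibility ⟹ `δ₁, δ₂` non-residues (`…D0BaseGlue`); the common bit `ε` by reciprocity
(`…D0RootUnitReciprocity`); model transport (`natCard_selmerGroup_smul`).  The `C₁` conjunct (`8·#ker Φ₃(B)`) is NOT here.
Everything is proved; no LINE 49 statement is restated; BSD is not advanced by this file alone.

## References

* [ShuZhai2021] J. Shu, S. Zhai, arXiv:2102.11808, Def. 1.1, Thm. 1.2.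
* [SilvermanAEC2009] J. H. Silverman, *The Arithmetic of Elliptic Curves*, 2nd ed., Prop. X.1.4, Thm. X.4.2.
* [Kane2013SelmerTwists] D. M. Kane, Algebra Number Theory 7 (2013), §2.
-/

noncomputable section

open scoped Classical

namespace Summit.BirchSwinnertonDyer.BirchSwinnertonDyer.Theorems.GenusKolyvaginAtTwo.TorsionCellSEL

open WeierstrassCurve WeierstrassCurve.Affine WeierstrassCurve.Affine.Point
open Literature.NumberTheory.GaloisRepresentations Literature.NumberTheory.EllipticCurves Field
open Literature.NumberTheory.EllipticCurves.TwoDescentLocal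
open Literature.NumberTheory.EllipticCurves.KramerTwoDescent
open Literature.NumberTheory.EllipticCurves.ShuZhai2021 (qStar IsInertInSqrt)
open Summit.BirchSwinnertonDyer.BirchSwinnertonDyer.Theorems.GenusKolyvaginAtTwo.TorsionCellD0
open Summit.BirchSwinnertonDyer.BirchSwinnertonDyer.Theorems.GenusKolyvaginAtTwo.FullVertex
open IsDedekindDomain NumberField Rat.HeightOneSpectrum Matrix

/-! ## `M₀ = ∏ q*` for primes `≡ 3 (mod 4)` -/

section QStar

/-- For primes `≡ 3 (mod 4)`: `∏_{q∈Q} q* = (−1)^{#Q} ∏_{q∈Q} q`. [cite: ShuZhai2021, §1] -/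
theorem prod_qStar_eq {Q : Finset ℕ} (hQ4 : ∀ q ∈ Q, q % 4 = 3) :
    ∏ q ∈ Q, qStar q = (-1) ^ Q.card * ∏ q ∈ Q, (q : ℤ) := by
  rw [Finset.prod_congr rfl fun q hq => qStar_eq_neg_of_emod_four_eq_three (hQ4 q hq), Finset.prod_neg]

/-- For primes `≡ 3 (mod 4)` with `∏ q* > 0`, `#Q` is even. [cite: ShuZhai2021, §1] -/
theorem even_card_of_prod_qStar_pos {Q : Finset ℕ} (hQ : ∀ q ∈ Q, q.Prime) (hQ4 : ∀ q ∈ Q, q % 4 = 3)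
    (hpos : 0 < ∏ q ∈ Q, qStar q) : Even Q.card := by
  by_contra hodd
  rw [Nat.not_even_iff_odd] at hodd
  rw [prod_qStar_eq hQ4, hodd.neg_one_pow] at hpos
  have hprod : (0 : ℤ) < ∏ q ∈ Q, (q : ℤ) := Finset.prod_pos fun q hq => by exact_mod_cast (hQ q hq).pos
  linarith

/-- For primes `≡ 3 (mod 4)` of even number, `∏ q* = ∏ q` as a rational number. [cite: ShuZhai2021, §1] -/
theorem cast_prod_qStar_eq {Q : Finset ℕ} (hQ4 : ∀ q ∈ Q, q % 4 = 3) (hk : Even Q.card) :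
    ((∏ q ∈ Q, qStar q : ℤ) : ℚ) = ∏ q ∈ Q, (q : ℚ) := by
  rw [prod_qStar_eq hQ4, hk.neg_one_pow, one_mul]
  push_cast
  rfl

end QStar

/-! ## The `C₀` conjunct -/

section C0

variable (E₀ : WeierstrassCurve ℚ) [E₀.IsElliptic] [E₀.IsGloballyMinimal]

/-- **THE `C₀` CONJUNCT OF THE ISO-CLASS SELMER PAIR LAW** (LINE 49 SEL, first half): `E₀/ℚ` globally minimal with two
independent rational `2`-torsion points, rank `0`, `Ш(E₀)[2] = 0`; `Q₀` a finite set of full-admissible primes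
(`(q, 2N₀) = 1`, `q` inert in `ℚ(√Δ(V))` for every `2`-isogenous `V`) with `∏ q* > 0`, ISO-CLASS relative to `N₀`
(`FullVertex.IsIsoClass`).  Then every model `C₀ = T • E₀^{(∏ q*)}` has `#C₀(ℚ)[2] = 4` and
`#Sel⁽²⁾(C₀/ℚ) = 4 · #ker Φ₃(redeiLaplacian Q₀)`.  [cite: ShuZhai2021, Def. 1.1, Thm. 1.2]
[cite: SilvermanAEC2009, Prop. X.1.4, Thm. X.4.2] [cite: Kane2013SelmerTwists, §2] -/
theorem isoClassSelmerLaw_C₀ [inst : DecidableEq ℚ] (hN : E₀.conductorNorm ℤ ≠ 0)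
    {P R : E₀.toAffine.Point} (hPR : P ≠ R) (hP0 : P ≠ 0) (hR0 : R ≠ 0) (hP2 : (2 : ℕ) • P = 0) (hR2 : (2 : ℕ) • R = 0)
    (hrank : E₀.mordellWeilRank = 0) (hsha : ∀ x ∈ E₀.sha, (2 : ℕ) • x = 0 → x = 0)
    {Q₀ : Finset ℕ}
    (hadm : ∀ q ∈ Q₀, q.Prime ∧ Nat.Coprime q (2 * E₀.conductorNorm ℤ) ∧
      ∀ (V : WeierstrassCurve ℚ) [V.IsElliptic], (∃ φ : Isogeny E₀ V, φ.degree = 2) → IsInertInSqrt q V.Δ)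
    (hpos : 0 < ∏ q ∈ Q₀, qStar q) (hiso : IsIsoClass (E₀.conductorNorm ℤ) Q₀)
    {C₀ : WeierstrassCurve ℚ} (hC₀ : ∃ T : VariableChange ℚ, T • E₀.quadraticTwist ((∏ q ∈ Q₀, qStar q : ℤ) : ℚ) = C₀) :
    Nat.card (AddSubgroup.torsionBy C₀.toAffine.Point ((2 : ℕ) : ℤ)) = 4 ∧
      Nat.card (C₀.selmerGroup ((2 : ℕ) : ℤ)) = 4 * Nat.card (LinearMap.ker (phi3 (redeiLaplacian Q₀)).mulVecLin) := by
  have e : inst = fun a b => Classical.propDecidable (a = b) := Subsingleton.elim _ _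
  subst e
  have h22 : ((2 : ℕ) : ℤ) = 2 := rfl
  obtain ⟨e₁, e₂, e₃, h⟩ := exists_splitTwoTorsion_of_two_torsion_points E₀ hPR hP0 hR0 hP2 hR2
  -- the primes of `Q₀`
  have hQ : ∀ q ∈ Q₀, q.Prime := fun q hq => (hadm q hq).1
  have hQ4 : ∀ q ∈ Q₀, q % 4 = 3 := fun q hq =>
    emod_four_eq_three_of_fullAdmissible E₀ (inst := _) hPR hP0 hR0 hP2 hR2 (hadm q hq).1 (hadm q hq).2.1 (hadm q hq).2.2
  have hk : Even Q₀.card := even_card_of_prod_qStar_pos hQ hQ4 hpos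
  have hd : ((∏ q ∈ Q₀, qStar q : ℤ) : ℚ) = ∏ q ∈ Q₀, (q : ℚ) := cast_prod_qStar_eq hQ4 hk
  have hQ0 : ∀ q ∈ Q₀, (q : ℚ) ≠ 0 := fun q hq => by exact_mod_cast (hQ q hq).ne_zero
  have hd0 : ∏ q ∈ Q₀, (q : ℚ) ≠ 0 := Finset.prod_ne_zero_iff.mpr hQ0
  rw [hd] at hC₀
  obtain ⟨T, rfl⟩ := hC₀
  refine ⟨natCard_torsionBy_two_smul_quadraticTwist E₀ (inst := _) h hd0 T, ?_⟩
  rw [natCard_selmerGroup_smul_quadraticTwist E₀ hd0, h22]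
  -- `Q₀ = ∅`: `E₀^{(1)} ≅ E₀`, `#Sel = 4`, empty matrix
  by_cases hQe : Q₀ = ∅
  · subst hQe
    rw [Finset.prod_empty]
    have hker : Nat.card (LinearMap.ker (phi3 (redeiLaplacian (∅ : Finset ℕ))).mulVecLin) = 1 :=
      (card_ker_mulVecLin_eq_one_iff_det_eq_one _).mpr (Matrix.det_eq_one_of_card_eq_zero (by simp))
    rw [hker, mul_one]
    have h1 := natCard_selmerGroup_smul_quadraticTwist_one E₀ (1 : VariableChange ℚ)
    rw [one_smul, h22] at h1
    rw [h1]
    exact E₀.natCard_selmerGroup_two_eq_four h hrank hsha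
  -- `Q₀ ≠ ∅`: the symbol-form count of part V-e
  obtain ⟨q₀, hq₀⟩ := Finset.nonempty_iff_ne_empty.mpr hQe
  -- the support set `S = primes(2N₀)`
  set S : Finset ℕ := (2 * E₀.conductorNorm ℤ).primeFactors with hSdef
  have hS : ∀ ℓ ∈ S, ℓ.Prime := fun _ hℓ => Nat.prime_of_mem_primeFactors hℓ
  have h2S : 2 ∈ S := Nat.mem_primeFactors.mpr ⟨Nat.prime_two, dvd_mul_right 2 _, mul_ne_zero two_ne_zero hN⟩
  have hgood : ∀ ℓ : ℕ, (hℓ : ℓ.Prime) → ℓ ∉ S → haveI : Fact ℓ.Prime := ⟨hℓ⟩;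
      padicValRat ℓ (e₁ - e₂) = 0 ∧ padicValRat ℓ (e₁ - e₃) = 0 ∧ padicValRat ℓ (e₂ - e₃) = 0 :=
    fun ℓ hℓ hℓS => padicValRat_sub_roots_eq_zero_of_not_mem_primeFactors E₀ h hN ℓ hℓ hℓS
  have hNS : ∀ ℓ : ℕ, ℓ.Prime → ℓ ∉ S → ¬ ℓ ∣ E₀.conductorNorm ℤ := by
    intro ℓ hℓ hℓS hdvd
    exact hℓS (Nat.mem_primeFactors.mpr ⟨hℓ, Dvd.dvd.mul_left hdvd 2, mul_ne_zero two_ne_zero hN⟩)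
  have hQS : ∀ q ∈ Q₀, q ∉ S := by
    intro q hq hqS
    exact (hQ q hq).ne_one (Nat.Coprime.eq_one_of_dvd (hadm q hq).2.1 (Nat.dvd_of_mem_primeFactors hqS))
  -- iso-class in pairwise symbol form
  have hiso8 : ∀ q ∈ Q₀, ∀ q' ∈ Q₀, q % 8 = q' % 8 := fun q hq q' hq' => (hiso q hq q' hq').1
  have hisoS : ∀ q ∈ Q₀, ∀ q' ∈ Q₀, ∀ ℓ ∈ S, (hℓ : ℓ.Prime) → ℓ ≠ 2 → haveI : Fact ℓ.Prime := ⟨hℓ⟩;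
      legendreSym ℓ ((q : ℤ) * q') = 1 := by
    intro q hq q' hq' ℓ hℓS hℓ hℓ2
    haveI : Fact ℓ.Prime := ⟨hℓ⟩
    have hℓN : ℓ ∈ (E₀.conductorNorm ℤ).primeFactors := by
      have hdvd := Nat.dvd_of_mem_primeFactors hℓS
      have : ℓ ∣ E₀.conductorNorm ℤ := by
        rcases (Nat.Prime.dvd_mul hℓ).mp hdvd with h2 | hN'
        · exact absurd ((Nat.prime_dvd_prime_iff_eq hℓ Nat.prime_two).mp h2) hℓ2
        · exact hN'
      exact Nat.mem_primeFactors.mpr ⟨hℓ, this, hN⟩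
    have hj := (hiso q hq q' hq').2 ℓ hℓN hℓ2
    -- `(−q/ℓ) = (−q'/ℓ)` ⟹ `(q/ℓ) = (q'/ℓ)` ⟹ `(qq'/ℓ) = (q/ℓ)² = 1`
    have hℓq : ¬ ℓ ∣ q := fun hd => hQS q hq (((Nat.prime_dvd_prime_iff_eq hℓ (hQ q hq)).mp hd) ▸ hℓS)
    have hℓq' : ¬ ℓ ∣ q' := fun hd => hQS q' hq' (((Nat.prime_dvd_prime_iff_eq hℓ (hQ q' hq')).mp hd) ▸ hℓS)
    have h0 : ((q : ℤ) : ZMod ℓ) ≠ 0 := by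
      rw [Ne, ZMod.intCast_zmod_eq_zero_iff_dvd]; exact_mod_cast hℓq
    have h0' : ((q' : ℤ) : ZMod ℓ) ≠ 0 := by
      rw [Ne, ZMod.intCast_zmod_eq_zero_iff_dvd]; exact_mod_cast hℓq'
    rw [← jacobiSym.legendreSym.to_jacobiSym, ← jacobiSym.legendreSym.to_jacobiSym, neg_eq_neg_one_mul (q : ℤ),
      neg_eq_neg_one_mul (q' : ℤ), legendreSym.mul, legendreSym.mul] at hj
    have hm1 : legendreSym ℓ (-1) ≠ 0 := by
      have h10 : ((-1 : ℤ) : ZMod ℓ) ≠ 0 := by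
        rw [Int.cast_neg, Int.cast_one]; exact neg_ne_zero.mpr one_ne_zero
      rcases legendreSym.eq_one_or_neg_one ℓ h10 with h1 | h1 <;> rw [h1] <;> decide
    have heq : legendreSym ℓ q = legendreSym ℓ q' := mul_left_cancel₀ hm1 hj
    rw [legendreSym.mul, heq]
    rcases legendreSym.eq_one_or_neg_one ℓ h0' with h1 | h1 <;> rw [h1] <;> norm_num
  -- full admissibility in residue bits
  obtain ⟨n₁, hn₁⟩ := exists_intCast_eq_four_mul_root E₀ h
  obtain ⟨n₂, hn₂⟩ := exists_intCast_eq_four_mul_root E₀ h.swap₁₂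
  obtain ⟨n₃, hn₃⟩ := exists_intCast_eq_four_mul_root E₀ h.swap₂₃.swap₁₂
  have hadm' : ∀ q ∈ Q₀, (hq : q.Prime) → haveI : Fact q.Prime := ⟨hq⟩;
      qrBit q ((e₁ - e₂) * (e₁ - e₃)) = 1 ∧ qrBit q ((e₂ - e₁) * (e₂ - e₃)) = 1 := by
    intro q hq hqp
    haveI : Fact q.Prime := ⟨hqp⟩
    have hq2 : q ≠ 2 := fun h2 => hQS q hq (h2 ▸ h2S)
    obtain ⟨g12, g13, g23⟩ := hgood q hqp (hQS q hq)
    obtain ⟨h₁, h₂, -⟩ := qrBit_delta_eq_one_of_forall_isogeny E₀ h hq2 hn₁ hn₂ hn₃ g12 g13 g23 (hadm q hq).2.2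
    exact ⟨h₁, h₂⟩
  -- the common bit `ε = qr_q(e₂ − e₁)`
  haveI hq₀F : Fact q₀.Prime := ⟨hQ q₀ hq₀⟩
  have hε : ∀ q ∈ Q₀, (hq : q.Prime) → haveI : Fact q.Prime := ⟨hq⟩; qrBit q (e₂ - e₁) = qrBit q₀ (e₂ - e₁) := by
    intro q hq hqp
    haveI : Fact q.Prime := ⟨hqp⟩
    refine qrBit_sub_roots_eq_of_intCast hn₁ hn₂ h.ne₁₂ S h2S (fun ℓ hℓ hℓS => (hgood ℓ hℓ hℓS).1)
      (by rw [qrBit_neg_one_eq_one_of_emod_four (hQ4 q hq), qrBit_neg_one_eq_one_of_emod_four (hQ4 q₀ hq₀)]) ?_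
    intro ℓ hℓ
    have := qrBit_kernel_eq_of_isoClass S Q₀ hS hQS hQ4 hiso8 hisoS hq hq₀ (Finset.singleton_subset_iff.mpr hℓ)
      (ε := 1) (Or.inl rfl)
    simpa using this
  -- the count of part V-e
  haveI : (E₀.quadraticTwist (∏ q ∈ Q₀, (q : ℚ))).IsElliptic := E₀.isElliptic_quadraticTwist hd0
  exact natCard_selmerGroup_twist_isoClass_eq E₀ S Q₀ h hS h2S hgood hNS hrank hsha hQ hQS hQ4 hk hq₀ hiso8 hisoS hadm' hε
    rfl

end C0

end Summit.BirchSwinnertonDyer.BirchSwinnertonDyer.Theorems.GenusKolyvaginAtTwo.TorsionCellSEL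

end
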